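import Summits.HodgeConjecture.HodgeConjecture.Theorems.NikulinTwinTransportRealMultiplicationSqrtTwoAlgebraic
import Summits.HodgeConjecture.HodgeConjecture.Theorems.NikulinTwinTransportTwinSimilitudeAlgebraicMarkings
import Literature.AlgebraicGeometry.Surfaces.K3Marking

/-!
# Crux `NikulinSerreCarrier` · line `neron-severi-intertwiner` · stub `stub_nikulinAnchorFrame` (S1) —
# Hodge rigidity of the anchor from "`Hom_Hdg(T(Y), H²(X)/NS(X))` has rank `≤ 1`"

Helper file (`--supports stmt-HodgeConjecture-14464`) for the field `rigid` of the anchor `AnchorFrame`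
(skeleton `Cruxes/NikulinSerreCarrier/Lines/neron-severi-intertwiner.lean`): `rigid` asks that EVERY rational
type-preserving `φ : H²(Y(ℂ); ℂ) → H²(X(ℂ); ℂ)` be `c·Ψ` modulo `NS(X)_ℂ := algebraicClasses X 1` on the
transcendental classes `T(Y)_ℂ := (algebraicClasses Y 1)^⊥`, `c ∈ ℚ`. The geometric input (very general
member of the van Geemen–Sarti family: `rk T(X) = 13` is odd, so the endomorphism field of the irreducible
Hodge structure `T(X)_ℚ` is totally real of degree dividing `13` with `dim_K T ≥ 3` unless CM — Huybrechts,
*Lectures on K3 Surfaces*, Ch. 3 Thm. 3.7 and §3.5 (ii); hence `End_Hdg(T(X)_ℚ) = ℚ` and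
`Hom_Hdg(T(Y)_ℚ, T(X)_ℚ) = ℚ·Ψ_T`) is taken here in the `Ψ`-FREE carrier form
"`Hom_Hdg(T(Y), H²(X)/NS(X))` has `ℚ`-rank at most one" (`hRig`: for rational type-preserving `φ₁, φ₂` with
`φ₂(T(Y)) ⊄ NS(X)_ℂ`, some rational `c` has `φ₁ ≡ c φ₂ mod NS(X)_ℂ` on `T(Y)_ℂ`), and this file supplies the
NON-DEGENERACY that turns it into `rigid` for the completed similitude `Ψ`: `Ψ` does not map `T(Y)_ℂ` into
`NS(X)_ℂ`, because the `(2,0)`-class `σ_Y` is transcendental (algebraic classes are `(1,1)`, Grothendieck's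
coniveau fact, and `H^{1,1} ⊥ σ`), `Ψ σ_Y` is a NON-ZERO `(2,0)`-class (`(Ψσ.Ψσ̄) = 2(σ.σ̄) ≠ 0`), and a non-zero
`(2,0)`-class is not `(1,1)` (`(σ.σ̄) > 0`, Huybrechts Ch. 6 Prop. 1.2), hence not algebraic.

* `cupProduct_conj_ne_zero_of_twoZero` — `σ ∪ σ̄ ≠ 0` for a non-zero `(2,0)`-class of a projective K3 surface;
* `not_mem_algebraicClasses_of_twoZero` — a non-zero `(2,0)`-class is not in `algebraicClasses X 1`;
* `rigid_of_homHdg_rank_le_one` — the field `AnchorFrame.rigid` for `Ψ` from `hRig` and the three named facts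
  `Huybrechts_K3_marking_exists`, `Huybrechts_K3_hodgeTypes_H2`, `Grothendieck1969_supportedClasses_le_hodgeConiveau`.
-/

noncomputable section

-- the doubled component `HodgeConjecture.HodgeConjecture` is the summit/problem layout (D-0022), not a slip
set_option linter.dupNamespace false

namespace Summit.HodgeConjecture.HodgeConjecture.Theorems.NikulinSerreCarrier.NeronSeveriIntertwiner

open CategoryTheory
open Literature.AlgebraicGeometry Literature.AlgebraicGeometry.Motives Literature.AlgebraicGeometry.HodgeTheory
open Literature.AlgebraicGeometry.Surfaces
open Literature.AlgebraicTopology.SingularHomology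
open Summit.HodgeConjecture.HodgeConjecture.Theorems.NikulinTwinTransport

variable {X Y : SchemeOver ℂ}

/-- **`σ ∪ σ̄ ≠ 0` for a non-zero `(2,0)`-class of a projective K3 surface** (Huybrechts Ch. 6 Prop. 1.2 (ii):
"`(σ.σ̄) > 0`"), GRANTED `Huybrechts_K3_marking_exists` (a marking `η` with period `x`, `re (x̄.x) > 0`,
`η⁻¹x` spanning the `(2,0)`-classes): `σ = t η⁻¹x`, `t ≠ 0`, and `σ ∪ σ̄ = |t|² (x.x̄) p ≠ 0`.
[cite: Huybrechts2016K3, Ch. 6 Prop. 1.2 (ii)] -/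
theorem cupProduct_conj_ne_zero_of_twoZero (hMk : Huybrechts_K3_marking_exists) (hX : IsK3Surface X) {σ : complexBetti X (2 * 1)} (hσ : IsOfHodgeType 2 X (2 * 1) 2 0 σ) (hσ0 : σ ≠ 0) :
    cupProduct (rfl : 2 * 1 + 2 * 1 = 2 * 2) σ (conjClass (ComplexPoints X) (2 * 1) σ) ≠ 0 := by
  obtain ⟨η, p, x, hp0, ⟨-, -, hint, hcup, h20, hspan⟩, ⟨-, hxpos, -⟩⟩ := hMk X hX
  -- `σ = t • η⁻¹ x` with `t ≠ 0`
  obtain ⟨t, rfl⟩ := hspan σ hσ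
  have ht : t ≠ 0 := by rintro rfl; exact hσ0 (zero_smul _ _)
  have hxx : k3Form (star x) x ≠ 0 := fun h ↦ by rw [h, Complex.zero_re] at hxpos; exact lt_irrefl _ hxpos
  rw [conjClass_smul, conjClass_marking_symm η hint, hcup, map_smul, map_smul, η.apply_symm_apply,
    η.apply_symm_apply, k3Form_smul_left, k3Form_smul_right, k3Form_comm x (star x), smul_ne_zero_iff]
  exact ⟨mul_ne_zero ht (mul_ne_zero ((map_ne_zero _).2 ht) hxx), hp0⟩

/-- **A non-zero `(2,0)`-class of a projective K3 surface is not an algebraic divisor class**: algebraic classes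
are of type `(1,1)` (Grothendieck's coniveau fact), `(1,1)`-classes are orthogonal to `σ̄` (Huybrechts Ch. 6
Prop. 1.2 (iii)), and `σ ∪ σ̄ ≠ 0`. [cite: Huybrechts2016K3, Ch. 6 Prop. 1.2] [cite: GrothendieckTopology1969, p. 300] -/
theorem not_mem_algebraicClasses_of_twoZero (hMk : Huybrechts_K3_marking_exists) (hHT : Huybrechts_K3_hodgeTypes_H2)
    (hG : Grothendieck1969_supportedClasses_le_hodgeConiveau) (hX : IsK3Surface X) {σ : complexBetti X (2 * 1)}
    (hσ : IsOfHodgeType 2 X (2 * 1) 2 0 σ) (hσ0 : σ ≠ 0) : σ ∉ algebraicClasses X 1 := by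
  intro hmem
  have h11 := isOfHodgeType_oneOne_of_mem_algebraicClasses hG hX hmem
  exact cupProduct_conj_ne_zero_of_twoZero hMk hX hσ hσ0 (((hHT X hX σ hσ hσ0).2.2 σ).1 h11).2

/-- **A `(2,0)`-class of a projective K3 surface is transcendental**: it is orthogonal to every algebraic divisor
class (algebraic classes are `(1,1)`, Grothendieck; `H^{1,1} ⊥ σ`, Huybrechts Ch. 6 Prop. 1.2 (iii); symmetry of
the cup product on `H²` read through a marking). [cite: Huybrechts2016K3, Ch. 6 Prop. 1.2 (iii)]
[cite: GrothendieckTopology1969, p. 300] -/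
theorem cupProduct_twoZero_eq_zero_of_mem_algebraicClasses (hMk : Huybrechts_K3_marking_exists)
    (hHT : Huybrechts_K3_hodgeTypes_H2) (hG : Grothendieck1969_supportedClasses_le_hodgeConiveau)
    (hY : IsK3Surface Y) {σ : complexBetti Y (2 * 1)} (hσ : IsOfHodgeType 2 Y (2 * 1) 2 0 σ) (hσ0 : σ ≠ 0)
    {d : complexBetti Y (2 * 1)} (hd : d ∈ algebraicClasses Y 1) :
    cupProduct (rfl : 2 * 1 + 2 * 1 = 2 * 2) σ d = 0 := by
  obtain ⟨η, p, x, -, ⟨-, -, -, hcup, -, -⟩, -⟩ := hMk Y hY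
  have hsymm : cupProduct (rfl : 2 * 1 + 2 * 1 = 2 * 2) σ d = cupProduct (rfl : 2 * 1 + 2 * 1 = 2 * 2) d σ := by
    rw [hcup, hcup, k3Form_comm]
  rw [hsymm]
  exact (((hHT Y hY σ hσ hσ0).2.2 d).1 (isOfHodgeType_oneOne_of_mem_algebraicClasses hG hY hd)).1

/-- **Hodge rigidity of the anchor (`AnchorFrame.rigid`) from the rank bound on
`Hom_Hdg(T(Y), H²(X)/NS(X))`.** Let `X, Y` be projective K3 surfaces, `p` a non-zero class of `H⁴(X(ℂ))`,
`p'` a MARKED class of `H⁴(Y(ℂ))` (cup products of `Y` read `k3Form • p'` through some marking), and `Ψ : H²(Y(ℂ); ℂ) →ₗ H²(X(ℂ); ℂ)` TYPE-PRESERVING and multiplying cup products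
by `2` (`x ∪ y = a p' ⟹ Ψx ∪ Ψy = 2a p`; rationality of `Ψ` enters only through `hRig`). ASSUME the rank bound
`hRig`: for all rational type-preserving `φ₁, φ₂ : H²(Y(ℂ)) → H²(X(ℂ))` such that `φ₂ t ∉ NS(X)_ℂ` for some
transcendental `t` (`t ⊥ algebraicClasses Y 1`), there is `c ∈ ℚ` with `φ₁ t − c φ₂ t ∈ NS(X)_ℂ` for all
transcendental `t` — the carrier form of `Hom_Hdg(T(Y)_ℚ, T(X)_ℚ) = ℚ·Ψ_T`, i.e. of `End_Hdg(T(X)_ℚ) = ℚ`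
for the very general member (`rk T(X) = 13` odd: Huybrechts Ch. 3 Thm. 3.7, §3.5 (ii)). Then, GRANTED the named
facts `Huybrechts_K3_marking_exists`, `Huybrechts_K3_hodgeTypes_H2`,
`Grothendieck1969_supportedClasses_le_hodgeConiveau`: every rational type-preserving `φ` is `c·Ψ` modulo
`NS(X)_ℂ` on the transcendental classes, `c ∈ ℚ` — because `Ψ` itself is non-degenerate there: the
`(2,0)`-class `σ_Y` is transcendental and `Ψ σ_Y` is a non-zero `(2,0)`-class, not algebraic.
[cite: Huybrechts2016K3, Ch. 3 Thm. 3.7 and Ch. 6 Prop. 1.2] -/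
theorem rigid_of_homHdg_rank_le_one (hMk : Huybrechts_K3_marking_exists) (hHT : Huybrechts_K3_hodgeTypes_H2)
    (hG : Grothendieck1969_supportedClasses_le_hodgeConiveau) (hX : IsK3Surface X) (hY : IsK3Surface Y)
    (p : complexBetti X (2 * 2)) (p' : complexBetti Y (2 * 2)) (hp0 : p ≠ 0)
    (hp'mk : ∃ η₀ : complexBetti Y (2 * 1) ≃ₗ[ℂ] (K3Index → ℂ),
      (∀ c : complexBetti Y (2 * 1), IsIntegralClass c ↔ ∃ v : K3Index → ℤ, η₀ c = fun i ↦ (v i : ℂ)) ∧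
      ∀ a b : complexBetti Y (2 * 1), cupProduct (rfl : 2 * 1 + 2 * 1 = 2 * 2) a b = k3Form (η₀ a) (η₀ b) • p')
    (Ψ : complexBetti Y (2 * 1) →ₗ[ℂ] complexBetti X (2 * 1))
    (hΨrat : ∀ x, IsRationalClass x → IsRationalClass (Ψ x))
    (hΨtype : ∀ (i j : ℕ) (x : complexBetti Y (2 * 1)),
      IsOfHodgeType 2 Y (2 * 1) i j x → IsOfHodgeType 2 X (2 * 1) i j (Ψ x))
    (hΨsim : ∀ (x y : complexBetti Y (2 * 1)) (a : ℂ),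
      cupProduct (rfl : 2 * 1 + 2 * 1 = 2 * 2) x y = a • p' →
        cupProduct (rfl : 2 * 1 + 2 * 1 = 2 * 2) (Ψ x) (Ψ y) = ((2 : ℂ) * a) • p)
    (hRig : ∀ φ₁ φ₂ : complexBetti Y (2 * 1) →ₗ[ℂ] complexBetti X (2 * 1),
      (∀ x, IsRationalClass x → IsRationalClass (φ₁ x)) →
      (∀ (i j : ℕ) (x : complexBetti Y (2 * 1)),
        IsOfHodgeType 2 Y (2 * 1) i j x → IsOfHodgeType 2 X (2 * 1) i j (φ₁ x)) →
      (∀ x, IsRationalClass x → IsRationalClass (φ₂ x)) →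
      (∀ (i j : ℕ) (x : complexBetti Y (2 * 1)),
        IsOfHodgeType 2 Y (2 * 1) i j x → IsOfHodgeType 2 X (2 * 1) i j (φ₂ x)) →
      (∃ t : complexBetti Y (2 * 1),
        (∀ d ∈ algebraicClasses Y 1, cupProduct (rfl : 2 * 1 + 2 * 1 = 2 * 2) t d = 0) ∧ φ₂ t ∉ algebraicClasses X 1) →
      ∃ c : ℚ, ∀ t : complexBetti Y (2 * 1),
        (∀ d ∈ algebraicClasses Y 1, cupProduct (rfl : 2 * 1 + 2 * 1 = 2 * 2) t d = 0) →
          φ₁ t - (c : ℂ) • φ₂ t ∈ algebraicClasses X 1) :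
    ∀ φ : complexBetti Y (2 * 1) →ₗ[ℂ] complexBetti X (2 * 1),
      (∀ x, IsRationalClass x → IsRationalClass (φ x)) →
      (∀ (i j : ℕ) (x : complexBetti Y (2 * 1)),
        IsOfHodgeType 2 Y (2 * 1) i j x → IsOfHodgeType 2 X (2 * 1) i j (φ x)) →
        ∃ c : ℚ, ∀ t : complexBetti Y (2 * 1),
          (∀ d ∈ algebraicClasses Y 1, cupProduct (rfl : 2 * 1 + 2 * 1 = 2 * 2) t d = 0) →
            φ t - (c : ℂ) • Ψ t ∈ algebraicClasses X 1 := by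
  intro φ hφrat hφtype
  refine hRig φ Ψ hφrat hφtype hΨrat hΨtype ?_
  -- the witness: the `(2,0)`-class of `Y`
  obtain ⟨σ, hσ0, hσ⟩ := hMk.exists_twoZero_ne_zero hY
  refine ⟨σ, fun d hd ↦ cupProduct_twoZero_eq_zero_of_mem_algebraicClasses hMk hHT hG hY hσ hσ0 hd, ?_⟩
  -- `Ψ σ` is a non-zero `(2,0)`-class: `Ψσ ∪ Ψσ̄ = 2 (σ ∪ σ̄) ≠ 0` read through the marked generator `p'`
  have hΨσ0 : Ψ σ ≠ 0 := by
    intro h0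
    obtain ⟨η₀, -, hη₀cup⟩ := hp'mk
    have hσσ := cupProduct_conj_ne_zero_of_twoZero hMk hY hσ hσ0
    have hs := hη₀cup σ (conjClass (ComplexPoints Y) (2 * 1) σ)
    have hs0 : k3Form (η₀ σ) (η₀ (conjClass (ComplexPoints Y) (2 * 1) σ)) ≠ 0 := by
      intro h; rw [h, zero_smul] at hs; exact hσσ hs
    have h2 := hΨsim σ (conjClass (ComplexPoints Y) (2 * 1) σ) _ hs
    rw [h0, map_zero, LinearMap.zero_apply] at h2
    rcases smul_eq_zero.1 h2.symm with h | h
    · exact mul_ne_zero two_ne_zero hs0 h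
    · exact hp0 h
  have hΨσ : IsOfHodgeType 2 X (2 * 1) 2 0 (Ψ σ) := hΨtype 2 0 σ hσ
  exact not_mem_algebraicClasses_of_twoZero hMk hHT hG hX hΨσ hΨσ0

/-- **Registered stub `stub_anchorRigidOfRankLeOne`** (crux item stmt-HodgeConjecture-14464, line
`neron-severi-intertwiner`, sub-goal of `stub_nikulinAnchorFrame`, field `AnchorFrame.rigid`): Hodge rigidity of
the anchor similitude from the rank bound on `Hom_Hdg(T(Y), H²(X)/NS(X))`, granted the three named facts —
verbatim `rigid_of_homHdg_rank_le_one`, with the registered one-line signature (fully qualified names).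
[cite: Huybrechts2016K3, Ch. 3 Thm. 3.7 and Ch. 6 Prop. 1.2] -/
theorem stub_anchorRigidOfRankLeOne : open Literature.AlgebraicGeometry.Motives Literature.AlgebraicGeometry.HodgeTheory Literature.AlgebraicGeometry.Surfaces Literature.AlgebraicTopology.SingularHomology in ∀ {X Y : SchemeOver ℂ}, Huybrechts_K3_marking_exists → Huybrechts_K3_hodgeTypes_H2 → Grothendieck1969_supportedClasses_le_hodgeConiveau → IsK3Surface X → IsK3Surface Y → ∀ (p : complexBetti X (2 * 2)) (p' : complexBetti Y (2 * 2)), p ≠ 0 → (∃ η₀ : complexBetti Y (2 * 1) ≃ₗ[ℂ] (K3Index → ℂ), (∀ c : complexBetti Y (2 * 1), IsIntegralClass c ↔ ∃ v : K3Index → ℤ, η₀ c = fun i ↦ (v i : ℂ)) ∧ ∀ a b : complexBetti Y (2 * 1), cupProduct (rfl : 2 * 1 + 2 * 1 = 2 * 2) a b = k3Form (η₀ a) (η₀ b) • p') → ∀ (Ψ : complexBetti Y (2 * 1) →ₗ[ℂ] complexBetti X (2 * 1)), (∀ x, IsRationalClass x → IsRationalClass (Ψ x)) → (∀ (i j : ℕ)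 (x : complexBetti Y (2 * 1)), IsOfHodgeType 2 Y (2 * 1) i j x → IsOfHodgeType 2 X (2 * 1) i j (Ψ x)) → (∀ (x y : complexBetti Y (2 * 1)) (a : ℂ), cupProduct (rfl : 2 * 1 + 2 * 1 = 2 * 2) x y = a • p' → cupProduct (rfl : 2 * 1 + 2 * 1 = 2 * 2) (Ψ x) (Ψ y) = ((2 : ℂ) * a) • p) → (∀ φ₁ φ₂ : complexBetti Y (2 * 1) →ₗ[ℂ] complexBetti X (2 * 1), (∀ x, IsRationalClass x → IsRationalClass (φ₁ x)) → (∀ (i j : ℕ) (x : complexBetti Y (2 * 1)), IsOfHodgeType 2 Y (2 * 1) i j x → IsOfHodgeType 2 X (2 * 1) i j (φ₁ x)) → (∀ x, IsRationalClass x → IsRationalClass (φ₂ x)) → (∀ (i j : ℕ) (x : complexBetti Y (2 * 1)), IsOfHodgeType 2 Y (2 * 1) i j x → IsOfHodgeType 2 X (2 * 1) i j (φ₂ x)) → (∃ t : complexBetti Y (2 * 1), (∀ d ∈ algebraicClasses Y 1, cupProduct (rfl : 2 * 1 + 2 * 1 = 2 * 2) t d = 0) ∧ φ₂ t ∉ algebraicClasses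 X 1) → ∃ c : ℚ, ∀ t : complexBetti Y (2 * 1), (∀ d ∈ algebraicClasses Y 1, cupProduct (rfl : 2 * 1 + 2 * 1 = 2 * 2) t d = 0) → φ₁ t - (c : ℂ) • φ₂ t ∈ algebraicClasses X 1) → ∀ φ : complexBetti Y (2 * 1) →ₗ[ℂ] complexBetti X (2 * 1), (∀ x, IsRationalClass x → IsRationalClass (φ x)) → (∀ (i j : ℕ) (x : complexBetti Y (2 * 1)), IsOfHodgeType 2 Y (2 * 1) i j x → IsOfHodgeType 2 X (2 * 1) i j (φ x)) → ∃ c : ℚ, ∀ t : complexBetti Y (2 * 1), (∀ d ∈ algebraicClasses Y 1, cupProduct (rfl : 2 * 1 + 2 * 1 = 2 * 2) t d = 0) → φ t - (c : ℂ) • Ψ t ∈ algebraicClasses X 1 :=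
  fun hMk hHT hG hX hY p p' hp0 hp'mk Ψ hΨrat hΨtype hΨsim hRig ↦
    rigid_of_homHdg_rank_le_one hMk hHT hG hX hY p p' hp0 hp'mk Ψ hΨrat hΨtype hΨsim hRig

end Summit.HodgeConjecture.HodgeConjecture.Theorems.NikulinSerreCarrier.NeronSeveriIntertwiner

end
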